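import Literature.AlgebraicGeometry.Frobenioids.Thm34SubStdHyp
import Literature.AlgebraicGeometry.Frobenioids.Thm34vSlim
import HarnessLib

/-!
# Frobenioids I, Theorem 3.4 sub-DAG: closers of `Thm34Sub` slots, tranche 2 — Theorem 3.4 (v) complete

Mochizuki, *The geometry of Frobenioids I*, Kyushu J. Math. **62** (2008), Thm. 3.4 (v) p. 63
[cite: MochizukiFrdI2008, Thm. 3.4 (v) p.63].

PROOF-ONLY file (abc-iut-L1-d8 = sole writer of the `Thm34Sub` closers). Tranche 2 closes the Thm. 3.4 (v)
slots `L12a_BaseIdentityEndosPreserved`, `L12b_BaseEquivalentPairsPreserved`, `L13_PsiBaseFunctor` and the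
assembly `Thm34v_FSM` of `Thm34Sub.lean`, by abc-iut-L1-d4's capstone
`PreFrobenioid.thm34v_conclusion_of_preserves_baseIso` (p413608; bricks `BaseEquivalencePreserved`,
`PsiBaseEquivalence`, `PsiBaseTransport`, `EquivalenceRigidComposites`) fed with the single input it needs from
the hypotheses (a) standard type + (b): `Ψ` and `Ψ⁻¹` preserve base-isomorphisms
(`FrdI.Thm34Sub.preservesBaseIso_of_stdHyp`, p413726).
-/

namespace Literature.AlgebraicGeometry.Frobenioids

namespace FrdI

namespace Thm34Sub

open CategoryTheory PreFrobenioidData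

universe w v v' u u'

variable {D₁ : Type u} [Category.{v} D₁] {Φ₁ : D₁ᵒᵖ ⥤ CommMonCat.{w}} {C₁ : Type u'} [Category.{v'} C₁]
  {D₂ : Type u} [Category.{v} D₂] {Φ₂ : D₂ᵒᵖ ⥤ CommMonCat.{w}} {C₂ : Type u'} [Category.{v'} C₂]
  (F₁ : C₁ ⥤ ElemFrobenioid Φ₁) (F₂ : C₂ ⥤ ElemFrobenioid Φ₂) (Ψ : C₁ ≌ C₂)

/-- **Thm. 3.4 (v) over FSM-type bases — CLOSED** (`Thm34v_FSM`): under (a) standard type, (b), Frobenioids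
over FSM-type bases and (c) `D₁, D₂` slim, `Ψ` preserves base-identity endomorphisms and base-equivalent
pairs, and there is a `1`-unique `Ψ^Base : D₁ → D₂` with the `1`-commutative square over `Base₁, Base₂`, both
composites rigid (abc-iut-L1-d4 `PreFrobenioid.thm34v_conclusion_of_preserves_baseIso` + `preservesBaseIso_of_stdHyp`).
[cite: MochizukiFrdI2008, Thm. 3.4 (v) p.63] -/
theorem thm34v_FSM_holds : Literature.AlgebraicGeometry.Frobenioids.FrdI.Thm34Sub.Thm34v_FSM F₁ F₂ Ψ :=
  fun h hs₁ hs₂ =>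
    PreFrobenioid.thm34v_conclusion_of_preserves_baseIso h.isFrobenioid₁ h.isFrobenioid₂ Ψ hs₁ hs₂
      (fun _ _ f hf => (preservesBaseIso_of_stdHyp F₁ F₂ Ψ h).1 f hf)
      (fun _ _ f hf => (preservesBaseIso_of_stdHyp F₁ F₂ Ψ h).2 f hf)

/-- `Thm34v_FSM` — `_holds` alias of `thm34v_FSM_holds` above under the fact's exact name (appended
2026-08-28, D-0026 bookkeeping: the proof term is the existing theorem of this file; no statement,
definition or attribute is edited; no new named fact; the ledger's debt table listed the fact
unproved). [cite: MochizukiFrdI2008, Thm. 3.4 (v) p.63] -/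
theorem _root_.Literature.AlgebraicGeometry.Frobenioids.FrdI.Thm34Sub.Thm34v_FSM_holds :
    Literature.AlgebraicGeometry.Frobenioids.FrdI.Thm34Sub.Thm34v_FSM F₁ F₂ Ψ :=
  _root_.Literature.AlgebraicGeometry.Frobenioids.FrdI.Thm34Sub.thm34v_FSM_holds (F₁ := F₁) (F₂ := F₂) (Ψ := Ψ)

/-- **SLOT (v)/L12a `BaseIdentityEndosPreserved` — CLOSED.** [cite: MochizukiFrdI2008, Thm. 3.4 (v) p.63] -/
theorem l12a_baseIdentityEndosPreserved_holds :
    Literature.AlgebraicGeometry.Frobenioids.FrdI.Thm34Sub.L12a_BaseIdentityEndosPreserved F₁ F₂ Ψ :=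
  fun h hs₁ hs₂ => (thm34v_FSM_holds F₁ F₂ Ψ h hs₁ hs₂).1

/-- **SLOT (v)/L12b `BaseEquivalentPairsPreserved` — CLOSED.** [cite: MochizukiFrdI2008, Thm. 3.4 (v) p.63] -/
theorem l12b_baseEquivalentPairsPreserved_holds :
    Literature.AlgebraicGeometry.Frobenioids.FrdI.Thm34Sub.L12b_BaseEquivalentPairsPreserved F₁ F₂ Ψ :=
  fun h hs₁ hs₂ => (thm34v_FSM_holds F₁ F₂ Ψ h hs₁ hs₂).2.1

/-- **SLOT (v)/L13 `PsiBaseFunctor` — CLOSED** (the extra inputs L12a/L12b of the slot are not needed: the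
capstone produces `Ψ^Base` directly). [cite: MochizukiFrdI2008, Thm. 3.4 (v) p.63] -/
theorem l13_psiBaseFunctor_holds :
    Literature.AlgebraicGeometry.Frobenioids.FrdI.Thm34Sub.L13_PsiBaseFunctor F₁ F₂ Ψ := by
  intro h hs₁ hs₂ _ _
  obtain ⟨ΨBase, hsq, -, -⟩ := (thm34v_FSM_holds F₁ F₂ Ψ h hs₁ hs₂).2.2
  exact ⟨ΨBase, hsq⟩

end Thm34Sub

end FrdI

end Literature.AlgebraicGeometry.Frobenioids
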